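import Mathlib
import HarnessLib
import Summits.FinalStateConjecture.FinalStateConjecture.Theses.DissipativeFinalMotions
import Summits.FinalStateConjecture.FinalStateConjecture.Theorems.DissipativeFinalMotionsFinalEraGenericOrientationHelpers
import Summits.FinalStateConjecture.FinalStateConjecture.Theorems.StarvedNecksFutureOrientedOfSeamedStubConeTimelike
import Summits.FinalStateConjecture.FinalStateConjecture.Theorems.StarvedNecksFutureOrientedOfSeamedStubNormSqTimeVector
import Literature.Geometry.Lorentzian.KerrDataProofs
import Literature.Geometry.Lorentzian.KerrSchildCoord
import Literature.Geometry.Lorentzian.KerrWaveEnergy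
import Literature.Geometry.Lorentzian.KerrFluxComparison

/-!
# Route DissipativeFinalMotions — crux `FinalEraGeneric` (stmt-FinalStateConjecture-17642), line `registered`:
# the hole charts of a rev-2 final era are future-oriented on their certified tubes (stub S3a)

* Kerr–Schild algebra at the axis pole `p = (τ, 0, 0, R)`: `r(p) = R`, `H(p) = M R/(R² + a²) ≤ 2/5` once
  `R ≥ 2 r₊` (sub-extremal), `g_{M,a}(e₀, V) = −1`.
* The certified slab piece `{t* = τ, m < r ≤ R}` is preconnected: it is the image of `(m, R] × S²` under
  the oblate spheroidal parametrisation (`Kerr.radius_spheroidal`, `Kerr.slice_eq_image_spheroidal`).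
* `tubeOrientation_chart` — over a general spacetime with a Cauchy hypersurface `S` and ONE late hole chart
  `Ψ` from the Kerr exterior into `O ⊆ J⁺(S)` whose pulled-back metric is `1/100`-close to Kerr–Schild in
  `C⁰` on `{x⁰ ≥ T, r ≤ 2ρ₀}` (`ρ₀ > r₊`): at every point of the certified slab `{t* = τ, r ≤ 2ρ₀}`, `τ > T`,
  `dΨ(V)`, `V = −g♯(dt*)`, is future-directed. It is timelike (cone algebra); at the pole a past sign would
  pass to `dΨ(e₀)` and the lift of the static axis worldline `s ↦ p + s e₀` would be a past-directed
  uniformly timelike ray inside `Ψ(late) ⊆ O ⊆ J⁺(S)` (`false_of_pastRay_subset_causalFuture`); one sign on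
  the preconnected slab piece carries the orientation from the pole to every point (`stub_oneSign`).
* `stub_tubeOrientation` — the registered stub S3a of the line, from clauses (O), (B), (P), (H1), (H2′),
  (ND) of `IsFinalEra₂`.

References: O'Neill 1983, Ch. 5, Lemma 5.26 ff. (p. 145), Ch. 14, Lemma 14.29; Dafermos–Rodnianski
arXiv:0811.0354, §5.1; Visser arXiv:0706.0622, (33)–(35); Dafermos–Luk arXiv:1710.01722, p. 8.
-/

noncomputable section

-- `<Problem> = <Summit>` doubles the namespace component (tree-wide convention)
set_option linter.dupNamespace false
-- instance search through nested operator types `E4 →L[ℝ] E4 →L[ℝ] ℝ`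
set_option maxSynthPendingDepth 3

open Set Filter Topology Function Metric
open scoped Manifold ContDiff ENNReal Topology
open Literature.Geometry.Lorentzian

namespace Summit.FinalStateConjecture.FinalStateConjecture.Theorems.DissipativeFinalMotions.FinalEraGeneric

open FutureOrientedOfSeamed.ClockDualityRays (stub_oneSign stub_coneTimelike stub_normSq_timeVector)

/-! ## Kerr–Schild algebra -/

/-- Clock duality `g_{M,a}(e₀, V) = −dt*(e₀) = −1` for `V = −g♯(dt*)`, wherever `r > 0`.
Dafermos–Rodnianski arXiv:0811.0354, §5.1. [folklore] -/
theorem kerr_bilin_basisVector_zero_timeVector {M a : ℝ} {x : E4} (hx : 0 < Kerr.radius a x) :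
    Kerr.bilin M a x (E4.basisVector 0) (Kerr.timeVector M a x) = -1 := by
  rw [Kerr.bilin_symm, Kerr.bilin_timeVector hx]
  simp [E4.basisVector]

/-- `r₊ > 0` and `M ≤ r₊` for sub-extremal parameters. O'Neill 1995, Ch. 2, §2.3. [folklore] -/
theorem rPlus_pos_and_M_le {M a : ℝ} (hMa : Kerr.IsSubextremal M a) :
    0 < Kerr.rPlus M a ∧ M ≤ Kerr.rPlus M a := by
  have hM := hMa.pos
  have hs := Real.sqrt_nonneg (M ^ 2 - a ^ 2)
  unfold Kerr.rPlus
  exact ⟨by linarith, by linarith⟩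

/-- **`H ≤ 2/5` on the axis beyond `2 r₊`.** For sub-extremal `(M, a)` and `R ≥ 2 r₊`:
`M R/(R² + a²) ≤ 2/5`, i.e. `2R² − 5MR + 2a² ≥ 0` — with `s = √(M² − a²)`,
`2R² − 5MR + 2a² = (R − 2M − 2s)(2R − M + 4s) + 6Ms + 6s²`. Visser arXiv:0706.0622, (33) (the
axis value of `H`). [folklore] -/
theorem axis_scalarH_bound {M a R : ℝ} (hMa : Kerr.IsSubextremal M a) (hR : 2 * Kerr.rPlus M a ≤ R) :
    M * R / (R ^ 2 + a ^ 2) ≤ 2 / 5 := by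
  have hM := hMa.pos
  set s := √(M ^ 2 - a ^ 2) with hs
  have hs0 : 0 ≤ s := Real.sqrt_nonneg _
  have ha2 : a ^ 2 < M ^ 2 := by
    have h := hMa
    unfold Kerr.IsSubextremal at h
    exact sq_lt_sq' (abs_lt.1 h).1 (abs_lt.1 h).2
  have hss : s ^ 2 = M ^ 2 - a ^ 2 := Real.sq_sqrt (by linarith)
  have hR' : 2 * M + 2 * s ≤ R := by unfold Kerr.rPlus at hR; linarith
  have hpos : 0 < R ^ 2 + a ^ 2 := by nlinarith
  rw [div_le_div_iff₀ hpos (by norm_num : (0 : ℝ) < 5)]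
  nlinarith [mul_nonneg (show (0 : ℝ) ≤ R - 2 * M - 2 * s by linarith)
    (show (0 : ℝ) ≤ 2 * R - M + 4 * s by linarith), mul_nonneg hM.le hs0]

/-- The axis pole `(t, 0, 0, R)` (`R > 0`) has Kerr–Schild radius `R` (`Kerr.radius_spheroidal` at the
unit vector `(0, 0, 1)`). O'Neill 1995, Ch. 2, §2.1. [folklore] -/
theorem radius_axisPole (a t : ℝ) {R : ℝ} (hR : 0 < R) :
    Kerr.radius a (E4.ofTimeSpace t (WithLp.toLp 2 ![0, 0, R] : E3)) = R := by
  rw [Kerr.radius_ofTimeSpace]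
  have hω : ‖(WithLp.toLp 2 ![0, 0, 1] : E3)‖ = 1 := by
    rw [EuclideanSpace.norm_eq, Fin.sum_univ_three]
    simp
  have h := Kerr.radius_spheroidal (a := a) hR hω
  have he : (WithLp.toLp 2 ![√(R ^ 2 + a ^ 2) * (WithLp.toLp 2 ![0, 0, 1] : E3) 0,
      √(R ^ 2 + a ^ 2) * (WithLp.toLp 2 ![0, 0, 1] : E3) 1, R * (WithLp.toLp 2 ![0, 0, 1] : E3) 2] : E3) =
      WithLp.toLp 2 ![0, 0, R] := by
    ext i
    fin_cases i <;> simp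
  rwa [he] at h

/-- `H = M R/(R² + a²)` at the axis pole `(t, 0, 0, R)`, `R > 0` (`z = r = R` there).
Visser arXiv:0706.0622, (33). [folklore] -/
theorem scalarH_axisPole (M a t : ℝ) {R : ℝ} (hR : 0 < R) :
    Kerr.scalarH M a (E4.ofTimeSpace t (WithLp.toLp 2 ![0, 0, R] : E3)) = M * R / (R ^ 2 + a ^ 2) := by
  unfold Kerr.scalarH
  rw [radius_axisPole a t hR]
  have h3 : (E4.ofTimeSpace t (WithLp.toLp 2 ![0, 0, R] : E3)) 3 = R := by
    show (E4.ofTimeSpace t (WithLp.toLp 2 ![0, 0, R] : E3)) (Fin.succ 2) = R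
    rw [E4.ofTimeSpace_apply_succ]
    simp
  rw [h3]
  have hpos : 0 < R ^ 2 + a ^ 2 := by positivity
  field_simp

/-! ## The certified slab piece is preconnected -/

/-- **The slab piece `{t* = τ, m < r ≤ R}` as a spheroidal image.** For `0 ≤ m`, the set
`E4.ofTimeSpace τ ∘ Φ '' ((m, R] × S²)`, `Φ(r, ω) = (√(r² + a²) ω₁, √(r² + a²) ω₂, r ω₃)` the oblate
spheroidal parametrisation: (i) it is preconnected; (ii) its points have `x⁰ = τ` and `m < r(x) ≤ R`;
(iii) every `x` with `x⁰ = τ`, `m < r(x) ≤ R` lies in it. O'Neill 1995, Ch. 2, §2.1 (`{r = c}` is the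
confocal ellipsoid `(x² + y²)/(c² + a²) + z²/c² = 1`). [folklore] -/
theorem slabPiece_spheroidal (a τ : ℝ) {m : ℝ} (hm : 0 ≤ m) (R : ℝ) :
    IsPreconnected ((fun p : ℝ × E3 ↦ E4.ofTimeSpace τ (WithLp.toLp 2
        ![√(p.1 ^ 2 + a ^ 2) * p.2 0, √(p.1 ^ 2 + a ^ 2) * p.2 1, p.1 * p.2 2] : E3)) ''
        (Ioc m R ×ˢ sphere (0 : E3) 1)) ∧
    (∀ x ∈ (fun p : ℝ × E3 ↦ E4.ofTimeSpace τ (WithLp.toLp 2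
        ![√(p.1 ^ 2 + a ^ 2) * p.2 0, √(p.1 ^ 2 + a ^ 2) * p.2 1, p.1 * p.2 2] : E3)) ''
        (Ioc m R ×ˢ sphere (0 : E3) 1),
      x 0 = τ ∧ m < Kerr.radius a x ∧ Kerr.radius a x ≤ R) ∧
    (∀ x : E4, x 0 = τ → m < Kerr.radius a x → Kerr.radius a x ≤ R →
      x ∈ (fun p : ℝ × E3 ↦ E4.ofTimeSpace τ (WithLp.toLp 2
        ![√(p.1 ^ 2 + a ^ 2) * p.2 0, √(p.1 ^ 2 + a ^ 2) * p.2 1, p.1 * p.2 2] : E3)) ''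
        (Ioc m R ×ˢ sphere (0 : E3) 1)) := by
  refine ⟨?_, ?_, ?_⟩
  · refine (isPreconnected_Ioc.prod Kerr.isConnected_sphere_E3.isPreconnected).image _ ?_
    exact ((E4.continuous_ofTimeSpace τ).comp (Kerr.continuous_spheroidal a)).continuousOn
  · rintro x ⟨⟨r, w⟩, ⟨⟨hr1, hr2⟩, hw⟩, rfl⟩
    have hw' : ‖w‖ = 1 := by simpa using hw
    have hr0 : 0 < r := hm.trans_lt hr1
    refine ⟨E4.ofTimeSpace_apply_zero τ _, ?_, ?_⟩
    · rw [Kerr.radius_ofTimeSpace, Kerr.radius_spheroidal hr0 hw']; exact hr1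
    · rw [Kerr.radius_ofTimeSpace, Kerr.radius_spheroidal hr0 hw']; exact hr2
  · intro x hx0 hxm hxR
    have hxe : E4.ofTimeSpace τ (E4.spatial x) = x := by
      have h := E4.ofTimeSpace_time_spatial x
      rwa [E4.time_apply, hx0] at h
    have hr0 : Kerr.radius a (E4.ofTimeSpace 0 (E4.spatial x)) = Kerr.radius a x := by
      rw [← Kerr.radius_ofTimeSpace a τ, hxe]
    have hmem : E4.spatial x ∈ {y : E3 | m < Kerr.radius a (E4.ofTimeSpace 0 y)} := by
      show m < Kerr.radius a (E4.ofTimeSpace 0 (E4.spatial x))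
      rw [hr0]; exact hxm
    rw [Kerr.slice_eq_image_spheroidal a hm] at hmem
    obtain ⟨⟨r, w⟩, ⟨hr, hw⟩, hrw⟩ := hmem
    have hw' : ‖w‖ = 1 := by simpa using hw
    have hr0' : 0 < r := hm.trans_lt hr
    have hrr : r = Kerr.radius a x := by
      rw [← hr0, ← hrw, Kerr.radius_spheroidal hr0' hw']
    refine ⟨⟨r, w⟩, ⟨⟨hr, hrr ▸ hxR⟩, hw⟩, ?_⟩
    dsimp only at hrw ⊢
    rw [hrw, hxe]

/-! ## The chart-local theorem -/

/-- **Hole charts pinned to Kerr–Schild on the certified tube are future-oriented there.** Let `𝓢` be a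
spacetime with a Cauchy hypersurface `S`, `O ⊆ J⁺(S)`, `(M, a)` sub-extremal, `ρ₀ > r₊`, and
`Ψ : {r > r₊} → 𝓢` a late chart into `O` after `T` (smooth; `Ψ({t* > T}) ⊆ O`) with
`‖(Ψ^* g − g_{M,a})(x)‖ ≤ 1/100` at every `x` with `x⁰ ≥ T`, `r(x) ≤ 2ρ₀`. Then for `τ > T` and every `x`
of the certified slab `{t* = τ, r ≤ 2ρ₀}`, `dΨ_x(V(x))` (`V = −g♯(dt*) = Kerr.timeVector`) is
future-directed causal. Proof: (1) `g_{M,a}(V, V) = −1 − 2H ≤ −1`, `‖V‖² ≤ 13`, so `dΨ(V)` is timelike on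
the slab piece (`stub_coneTimelike`); (2) at the pole `p = (τ, 0, 0, 2ρ₀)` (`r = 2ρ₀ ≥ 2r₊`, `H ≤ 2/5`)
`g(dΨ e₀, dΨ e₀) ≤ −1 + 4/5 + 1/100`, and the same bound holds along the static axis worldline
`s ↦ p + s e₀` (time translation invariance of `r`, `H`, `g_{M,a}`), which stays in the pinned tube; were
`dΨ_p(e₀)` past-directed, its lift would be a past-directed uniformly timelike ray in
`Ψ({t* > T}) ⊆ O ⊆ J⁺(S)`, impossible (`false_of_pastRay_subset_causalFuture`); (3) clock duality
`g_{M,a}(e₀, V) = −1` hands the orientation of `dΨ_p(e₀)` to `dΨ_p(V(p))`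
(`TimeOrientation.isFutureDirected_of_val_lt_zero`); (4) the slab piece `{t* = τ, r₊ < r ≤ 2ρ₀}` is
preconnected (spheroidal image of `(r₊, 2ρ₀] × S²`) and contains `x` and `p`, so one sign
(`stub_oneSign`). O'Neill 1983, Ch. 5, Lemma 5.26 ff., Ch. 14, Lemma 14.29; Dafermos–Rodnianski
arXiv:0811.0354, §5.1. [folklore] -/
theorem tubeOrientation_chart (𝓢 : Spacetime.{0} 4) {S O : Set 𝓢.carrier}
    (hS : 𝓢.metric.IsCauchyHypersurface 𝓢.timeOrientation S)
    (hOS : O ⊆ 𝓢.metric.causalFuture 𝓢.timeOrientation S) {M a : ℝ} (hMa : Kerr.IsSubextremal M a)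
    {ρ₀ : ℝ} (hρ₀ : Kerr.rPlus M a < ρ₀) {T : ℝ} (Ψ : (Kerr.background M a).domain → 𝓢.carrier)
    (hΨ : 𝓢.IsLateChart (Kerr.background M a) O T Ψ)
    (hpin : ∀ x : (Kerr.background M a).domain, T ≤ x.1 0 → Kerr.radius a x.1 ≤ 2 * ρ₀ →
      ‖𝓢.deviation (Kerr.background M a) Ψ x‖ ≤ 1 / 100)
    {τ : ℝ} (hτ : T < τ) (x : (Kerr.background M a).domain)
    (hx : x ∈ (Kerr.background M a).truncTimeSlab (2 * ρ₀) τ) :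
    𝓢.timeOrientation.IsFutureDirected
      (mfderiv 𝓘(ℝ, E4) (𝓡 4) Ψ x (Kerr.timeVector M a x.1)) := by
  have hM : 0 < M := hMa.pos
  obtain ⟨hm0, hMm⟩ := rPlus_pos_and_M_le hMa
  set m := Kerr.rPlus M a with hm
  set R := 2 * ρ₀ with hR
  have hmR : m < R := by rw [hR]; linarith
  have h2mR : 2 * m ≤ R := by rw [hR]; linarith
  have hR0 : 0 < R := hm0.trans hmR
  -- membership in the exterior `{r > max r₊ 0}` = `{r > r₊}`
  have hmax : max (Kerr.rPlus M a) 0 = m := max_eq_left hm0.le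
  have hmem_ext : ∀ z : E4, z ∈ ((Kerr.background M a).domain : Set E4) ↔ m < Kerr.radius a z := fun z ↦ by
    show z ∈ Kerr.exterior M a ↔ _
    rw [Kerr.mem_exterior, hmax]
  have hrad_pos : ∀ z : (Kerr.background M a).domain, 0 < Kerr.radius a z.1 := fun z ↦
    hm0.trans ((hmem_ext z.1).1 z.2)
  -- (1) `dΨ(V)` is timelike at the pinned points of the slab
  have hdev20 : ∀ z : (Kerr.background M a).domain, T ≤ z.1 0 → Kerr.radius a z.1 ≤ R →
      ‖𝓢.deviation (Kerr.background M a) Ψ z‖ ≤ 1 / (20 * (1 : ℝ)) := fun z hzT hzR ↦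
    (hpin z hzT hzR).trans (by norm_num : (1 : ℝ) / 100 ≤ 1 / (20 * (1 : ℝ)))
  have hVV : ∀ z : (Kerr.background M a).domain, (Kerr.background M a).bilin z.1 (Kerr.timeVector M a z.1) (Kerr.timeVector M a z.1) ≤ -1 :=
    fun z ↦ by
    show Kerr.bilin M a z.1 _ _ ≤ -1
    rw [Kerr.bilin_timeVector_timeVector (hrad_pos z)]
    linarith [Kerr.scalarH_nonneg hM.le a z.1]
  have hVn : ∀ z : (Kerr.background M a).domain, ‖Kerr.timeVector M a z.1‖ ^ 2 ≤ 13 * (1 : ℝ) := fun z ↦ by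
    rw [mul_one]
    exact stub_normSq_timeVector hM.le (hrad_pos z) (Kerr.scalarH_le_one hMa z.2)
  have htl : ∀ z : (Kerr.background M a).domain, T ≤ z.1 0 → Kerr.radius a z.1 ≤ R →
      𝓢.metric.IsTimelike (mfderiv 𝓘(ℝ, E4) (𝓡 4) Ψ z (Kerr.timeVector M a z.1)) :=
    fun z hzT hzR ↦ stub_coneTimelike 𝓢 (Kerr.background M a) Ψ z _ one_pos (hVV z) (hVn z) (hdev20 z hzT hzR)
  -- (2) the pole `p = (τ, 0, 0, R)`
  set pE : E4 := E4.ofTimeSpace τ (WithLp.toLp 2 ![0, 0, R] : E3) with hpE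
  have hp_rad : Kerr.radius a pE = R := radius_axisPole a τ hR0
  have hp0 : pE 0 = τ := E4.ofTimeSpace_apply_zero τ _
  have hp_mem : pE ∈ ((Kerr.background M a).domain : Set E4) := (hmem_ext pE).2 (hp_rad ▸ hmR)
  set p : (Kerr.background M a).domain := ⟨pE, hp_mem⟩ with hp
  have hHp : Kerr.scalarH M a pE ≤ 2 / 5 := by
    rw [hpE, scalarH_axisPole M a τ hR0]
    exact axis_scalarH_bound hMa h2mR
  -- the static axis worldline `Q s = p + s e₀`
  set Q : ℝ → E4 := fun s ↦ pE + s • E4.basisVector 0 with hQ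
  have hQ0 : ∀ s, Q s 0 = τ + s := fun s ↦ by
    simp only [hQ, PiLp.add_apply, PiLp.smul_apply, smul_eq_mul, hp0, E4.basisVector,
      PiLp.single_apply, if_true, mul_one]
  have hQrad : ∀ s, Kerr.radius a (Q s) = R := fun s ↦ by
    rw [hQ]; show Kerr.radius a (pE + s • E4.basisVector 0) = R
    rw [Kerr.radius_add_time_smul_basisVector, hp_rad]
  have hQH : ∀ s, Kerr.scalarH M a (Q s) = Kerr.scalarH M a pE := fun s ↦
    Kerr.scalarH_add_smul_basisVector_zero M a pE s
  have hQmem : ∀ s, Q s ∈ ((Kerr.background M a).domain : Set E4) := fun s ↦ (hmem_ext (Q s)).2 (hQrad s ▸ hmR)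
  set cur : ℝ → (Kerr.background M a).domain := fun s ↦ ⟨Q s, hQmem s⟩ with hcur
  have hcurval : ∀ s : ℝ, (cur s : E4) = Q s := fun s ↦ rfl
  have hcur0 : cur 0 = p := Subtype.ext (by simp [hcur, hQ, hp])
  -- deviation and cone bounds along the worldline for `s ≥ 0`
  have hdevs : ∀ s, 0 ≤ s → ‖𝓢.deviation (Kerr.background M a) Ψ (cur s)‖ ≤ 1 / 100 := fun s hs ↦
    hpin (cur s) (by show T ≤ Q s 0; rw [hQ0]; linarith) (by show Kerr.radius a (Q s) ≤ R; rw [hQrad])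
  have he0n : ‖(E4.basisVector 0 : E4)‖ = 1 := by simp [E4.basisVector]
  have hcone : ∀ s, 0 ≤ s →
      𝓢.metric.val (Ψ (cur s)) (mfderiv 𝓘(ℝ, E4) (𝓡 4) Ψ (cur s) (E4.basisVector 0))
        (mfderiv 𝓘(ℝ, E4) (𝓡 4) Ψ (cur s) (E4.basisVector 0)) ≤ -(19 / 100) := by
    intro s hs
    have h := val_mfderiv_le 𝓢 (Kerr.background M a) Ψ (cur s) (E4.basisVector 0) (E4.basisVector 0)
    have hb : (Kerr.background M a).bilin (cur s).1 (E4.basisVector 0) (E4.basisVector 0) =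
        -1 + 2 * Kerr.scalarH M a pE := by
      show Kerr.bilin M a (Q s) _ _ = _
      -- `g_{M,a}(e₀, e₀) = −1 + 2H` (`ℓ(e₀) = 1`; cf. `TameCensorship.Negative.kerrBilin_e0_e0`)
      rw [Kerr.bilin_apply, Kerr.nullCovector_basisVector_zero, Minkowski.bilin_basisVector_zero, hQH]
      ring
    rw [hb, he0n, mul_one, mul_one] at h
    linarith [hdevs s hs]
  -- the lifted worldline `γ = Ψ ∘ cur`
  have hQdiff : ContDiff ℝ ∞ Q := contDiff_const.add (contDiff_id.smul contDiff_const)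
  have hQ' : ∀ t, HasDerivAt Q (E4.basisVector 0) t := fun t ↦ by
    have h := ((hasDerivAt_id t).smul_const (E4.basisVector 0 : E4)).const_add pE
    rwa [one_smul] at h
  obtain ⟨hγ, hvel⟩ := curve_lift hΨ.contMDiff hQdiff hQ' (c := cur) hcurval
  set γ : ℝ → 𝓢.carrier := Ψ ∘ cur with hγdef
  -- at the pole: `dΨ e₀` is timelike, hence future- or past-directed; past is impossible
  have hpt : 𝓢.metric.IsTimelike (mfderiv 𝓘(ℝ, E4) (𝓡 4) Ψ p (E4.basisVector 0)) := by
    have h := hcone 0 le_rfl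
    rw [hcur0] at h
    exact lt_of_le_of_lt h (by norm_num)
  have hfutA : 𝓢.timeOrientation.IsFutureDirected (mfderiv 𝓘(ℝ, E4) (𝓡 4) Ψ p (E4.basisVector 0)) := by
    rcases 𝓢.timeOrientation.isFutureDirected_or_isPastDirected_of_isCausal hpt.isCausal with
      hfut | hpast
    · exact hfut
    exfalso
    have hk0 : (0 : ℝ) < 19 / 100 := by norm_num
    have hspeed : ∀ s : ℝ, 0 ≤ s →
        𝓢.metric.val (γ s) (velocity (𝓡 4) γ s) (velocity (𝓡 4) γ s) ≤ -(19 / 100) := by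
      intro s hs
      rw [(hvel s).2]
      exact hcone s hs
    have htls : ∀ s : ℝ, 0 ≤ s → 𝓢.metric.IsTimelike (velocity (𝓡 4) γ s) := fun s hs ↦
      lt_of_le_of_lt (hspeed s hs) (by norm_num)
    -- the sign function `f(s) = g(T, γ')(s)` is continuous, nowhere zero on `[0, ∞)`, positive at `0`
    set f : ℝ → ℝ := fun s ↦
      𝓢.metric.val (γ s) (𝓢.timeOrientation.vectorField (γ s)) (velocity (𝓡 4) γ s) with hf
    have hcont : Continuous f :=
      (LorentzianMetric.continuous_val_snd_snd 𝓢.metric 𝓢.timeOrientation).2.comp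
        (LorentzianMetric.continuous_tangentLift (hγ.of_le one_le_infty'))
    have hne : ∀ s : ℝ, 0 ≤ s → f s ≠ 0 := fun s hs ↦
      𝓢.metric.val_ne_zero_of_isTimelike_of_isCausal (𝓢.timeOrientation.isTimelike _)
        (htls s hs).isCausal
    have hf0 : 0 < f 0 := by
      have he0 : f 0 = 𝓢.metric.val (Ψ (cur 0)) (𝓢.timeOrientation.vectorField (Ψ (cur 0)))
          (mfderiv 𝓘(ℝ, E4) (𝓡 4) Ψ (cur 0) (E4.basisVector 0)) := by
        simp only [hf]
        rw [(hvel 0).2]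
        rfl
      rw [he0, hcur0]
      exact hpast.2
    have hfpos : ∀ s : ℝ, 0 ≤ s → 0 < f s := by
      intro s hs
      by_contra hfs
      have hfs' : f s ≤ 0 := not_lt.mp hfs
      obtain ⟨r, hr, hr0⟩ := intermediate_value_Icc' hs hcont.continuousOn ⟨hfs', hf0.le⟩
      exact hne r hr.1 hr0
    -- the ray stays in the chart image of the late region, hence in `O ⊆ J⁺(S)`
    have hmemJ : ∀ s : ℝ, 0 ≤ s → γ s ∈ 𝓢.metric.causalFuture 𝓢.timeOrientation S := by
      intro s hs
      have h1 : γ s ∈ Ψ '' (Kerr.background M a).lateRegion T := by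
        refine mem_image_of_mem Ψ ?_
        show T < Q s 0
        rw [hQ0]; linarith
      exact hOS (hΨ.image_subset h1)
    have hray : ∀ s : ℝ, 0 ≤ s → MDifferentiableAt 𝓘(ℝ, ℝ) (𝓡 4) γ s ∧
        𝓢.metric.val (γ s) (velocity (𝓡 4) γ s) (velocity (𝓡 4) γ s) ≤ -(19 / 100) ∧
        𝓢.timeOrientation.IsPastDirected (velocity (𝓡 4) γ s) := fun s hs ↦
      ⟨(hvel s).1, hspeed s hs, (htls s hs).isCausal, hfpos s hs⟩
    exact NeckGapDecay.ConnectionLevelCones.OrientationAnchorStub.false_of_pastRay_subset_causalFuture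
      (g := 𝓢.metric) (τ := 𝓢.timeOrientation) (γ := γ) two_le_infty' hS hk0 hray hmemJ
  -- (3) handshake at the pole: `g(dΨ e₀, dΨ V) ≤ -1 + ‖dev‖ ‖V‖ < 0`
  have hτT : T ≤ τ := hτ.le
  have hdevp : ‖𝓢.deviation (Kerr.background M a) Ψ p‖ ≤ 1 / 100 := hpin p (by rw [show p.1 0 = τ from hp0]; exact hτT)
    (by rw [show Kerr.radius a p.1 = R from hp_rad])
  have hWc : 𝓢.metric.IsCausal (mfderiv 𝓘(ℝ, E4) (𝓡 4) Ψ p (Kerr.timeVector M a pE)) :=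
    (htl p (by rw [show p.1 0 = τ from hp0]; exact hτT) (by rw [show Kerr.radius a p.1 = R from hp_rad])).isCausal
  have hfdp : 𝓢.timeOrientation.IsFutureDirected
      (mfderiv 𝓘(ℝ, E4) (𝓡 4) Ψ p (Kerr.timeVector M a pE)) := by
    have h := val_mfderiv_le 𝓢 (Kerr.background M a) Ψ p (E4.basisVector 0) (Kerr.timeVector M a pE)
    have hb : (Kerr.background M a).bilin p.1 (E4.basisVector 0) (Kerr.timeVector M a pE) = -1 :=
      kerr_bilin_basisVector_zero_timeVector (hrad_pos p)
    rw [hb, he0n, mul_one] at h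
    have hV4 : ‖Kerr.timeVector M a pE‖ ≤ 4 := by
      have h13 := hVn p
      rw [mul_one] at h13
      nlinarith [norm_nonneg (Kerr.timeVector M a pE)]
    have hneg : 𝓢.metric.val (Ψ p) (mfderiv 𝓘(ℝ, E4) (𝓡 4) Ψ p (E4.basisVector 0))
        (mfderiv 𝓘(ℝ, E4) (𝓡 4) Ψ p (Kerr.timeVector M a pE)) < 0 := by
      have h2 : ‖𝓢.deviation (Kerr.background M a) Ψ p‖ * ‖Kerr.timeVector M a pE‖ ≤ 1 / 100 * 4 :=
        mul_le_mul hdevp hV4 (norm_nonneg _) (by norm_num)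
      linarith
    exact 𝓢.timeOrientation.isFutureDirected_of_val_lt_zero hfutA hpt hWc hneg
  -- (4) one sign on the preconnected slab piece `{t* = τ, r₊ < r ≤ R}`
  obtain ⟨hSpre, hSmem, hScov⟩ := slabPiece_spheroidal a τ hm0.le R
  set Spc := (fun q : ℝ × E3 ↦ E4.ofTimeSpace τ (WithLp.toLp 2
      ![√(q.1 ^ 2 + a ^ 2) * q.2 0, √(q.1 ^ 2 + a ^ 2) * q.2 1, q.1 * q.2 2] : E3)) ''
      (Ioc m R ×ˢ sphere (0 : E3) 1) with hSpc
  have hSO : Spc ⊆ ((Kerr.background M a).domain : Set E4) := fun z hz ↦ (hmem_ext z).2 (hSmem z hz).2.1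
  have hVc : ContinuousOn (Kerr.timeVector M a) ((Kerr.background M a).domain : Set E4) := fun z hz ↦
    (Kerr.contDiffAt_timeVector M a (hm0.trans ((hmem_ext z).1 hz)) (n := 0)).continuousAt.continuousWithinAt
  have hc : ∀ z : (Kerr.background M a).domain, (z : E4) ∈ Spc →
      𝓢.metric.IsCausal (mfderiv 𝓘(ℝ, E4) (𝓡 4) Ψ z (Kerr.timeVector M a z)) := fun z hz ↦
    (htl z (by rw [(hSmem z hz).1]; exact hτT) (hSmem z hz).2.2).isCausal
  have hpS : (p : E4) ∈ Spc := hScov pE hp0 (hp_rad ▸ hmR) hp_rad.le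
  have hxS : (x : E4) ∈ Spc := hScov x.1 hx.1 ((hmem_ext x.1).1 x.2) hx.2
  exact stub_oneSign 𝓢 (Kerr.background M a) Ψ hΨ.contMDiff (Kerr.timeVector M a) hVc hSpre hSO hc p hpS hfdp x hxS

/-! ## The registered stub S3a -/

/-- **S3a — HOLE CHARTS OF A REV-2 ERA ARE FUTURE-ORIENTED ON THEIR CERTIFIED TUBES** (registered stub
`stub_tubeOrientation` of line `registered` of the crux `FinalEraGeneric`). For an admissible datum, a
maximal development with complete `𝓘⁺` and ANY tuple satisfying `IsFinalEra₂`: for every hole `i`, chart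
time `τ > T` and point `x` of `{t*ᵢ = τ, rᵢ ≤ 2ρ₀}`, `dΨᵢ(V_{Mᵢ,aᵢ})` is future-directed causal —
`tubeOrientation_chart` for the chart of hole `i`, fed by clauses (O) (`O ⊆ J⁺(ι X)`, `ι X` the Cauchy
hypersurface of the development), (B) (`B i` is the Kerr background `(Mᵢ, aᵢ)`), (P) (sub-extremal),
(H1) (late chart), (H2′) at `m = 0` (`C⁰` pin `1/100`), (ND) (`r₊ < ρ₀`). (Admissibility, maximality and
complete `𝓘⁺` are not used.) O'Neill 1983, Ch. 5, Lemma 5.26, Ch. 14, Lemma 14.29; Dafermos–Rodnianski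
arXiv:0811.0354, §5.1. [folklore] -/
theorem stub_tubeOrientation : open scoped Manifold in ∀ (X : Type) [TopologicalSpace X] [ChartedSpace (EuclideanSpace ℝ (Fin 3)) X] [IsManifold (𝓡 3) ((⊤ : ℕ∞) : WithTop ℕ∞) X] [T2Space X] [SecondCountableTopology X] [ConnectedSpace X], ∀ D ∈ Literature.Geometry.Lorentzian.admissibleVacuumData X, ∀ 𝒟 : Literature.Geometry.Lorentzian.VacuumCauchyDevelopment D, 𝒟.IsMaximal → Summit.FinalStateConjecture.HasCompleteNullInfinity 𝒟.toCauchyDevelopment → ∀ (N : ℕ) (M a : Fin N → ℝ) (T δ V C₁ C₂ ρ₀ κ : ℝ) (ξ : Fin N → ℝ → EuclideanSpace ℝ (Fin 3)) (β : ℝ → ℝ) (U₀ : TopologicalSpace.Opens Literature.Geometry.Lorentzian.E4) (B₀ : Literature.Geometry.Lorentzian.ModelBackground) (B : Fin N → Literature.Geometry.Lorentzian.ModelBackground) (Ψ₀ : B₀.domain → 𝒟.carrier) (Ψ : (i : Fin N) → (B i).domain → 𝒟.carrier) (O : Set 𝒟.carrier), 𝒟.toCauchyDevelopment.IsFinalEra₂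 N M a T δ V C₁ C₂ ρ₀ κ ξ β U₀ B₀ B Ψ₀ Ψ O → (∀ i (τ : ℝ), T < τ → ∀ x ∈ (B i).truncTimeSlab (2 * ρ₀) τ, 𝒟.toSpacetime.timeOrientation.IsFutureDirected (mfderiv 𝓘(ℝ, Literature.Geometry.Lorentzian.E4) (𝓡 4) (Ψ i) x (Literature.Geometry.Lorentzian.Kerr.timeVector (M i) (a i) x.1))) := by
  intro X _ _ _ _ _ _ D _ 𝒟 _ _ N M a T δ V C₁ C₂ ρ₀ κ ξ β U₀ B₀ B Ψ₀ Ψ O hera i τ hτ x hx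
  obtain ⟨h₁, -, h₃, h₄, -, -, -, -, -, -, -, -, -, -, -, -, -, -, -, -, h₂₁, h₂₂, -, -, -, -, -, -,
    -, -, h₃₁⟩ := hera
  subst h₃
  have hOS : O ⊆ 𝒟.metric.causalFuture 𝒟.timeOrientation (range 𝒟.embed) := by
    rw [h₁]; exact inter_subset_left
  have hpin : ∀ y : (Kerr.background (M i) (a i)).domain, T ≤ y.1 0 →
      Kerr.radius (a i) y.1 ≤ 2 * ρ₀ →
        ‖𝒟.toSpacetime.deviation (Kerr.background (M i) (a i)) (Ψ i) y‖ ≤ 1 / 100 := by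
    intro y hyT hyR
    have h := h₂₂ i 0 y (Nat.zero_le 2) hyT hyR
    rwa [norm_iteratedFDeriv_zero, Spacetime.deviationExtend_coe, pow_zero, mul_one] at h
  exact tubeOrientation_chart 𝒟.toSpacetime 𝒟.isCauchyHypersurface hOS (h₄ i) (h₃₁ i) (Ψ i) (h₂₁ i)
    hpin hτ x hx

end Summit.FinalStateConjecture.FinalStateConjecture.Theorems.DissipativeFinalMotions.FinalEraGeneric

end
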